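import Summits.KontsevichZagierPeriods.KontsevichZagierPeriods.Theses.ComplexOrientations
import Literature.AlgebraicGeometry.RealAlgebraic.DividingCurves
import Literature.Algebra.EuclideanLattices.EllipseResidueClassCounting
import HarnessLib

/-!
# Route ComplexOrientations — the ellipse as an oval: components of its complement, its
# interior and its area (calibration input for `ComplexOrientationIdentity` on conics)

For a positive definite binary form `Q(x) = A x₀² + B x₀x₁ + C x₁²` (`A > 0`,
`D = 4AC − B² > 0`), a centre `c ∈ ℝ²` and `ρ > 0`, the ellipse `Z = {v | Q(v − c) = ρ}` in the
plane `Fin 2 → ℝ` is connected; its complement consists of the two connected open sets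
`{Q(· − c) < ρ}` (bounded) and `{ρ < Q(· − c)}` (unbounded), which are therefore the connected
components of `Zᶜ`; hence the route's `ovalInterior Z` (points off `Z` whose component in `Zᶜ`
is bounded) is `{Q(· − c) < ρ}`, of Lebesgue area `2πρ/√D` — a real-algebraic multiple of `π`
when `A, B, C, ρ` are rational. Everything is proved; the inputs are the tree's ellipse area
`Literature.Algebra.EuclideanLattices.volume_real_binQF_le` and polar coordinates.

This is the geometric half of the unconditional CONIC SLICE of the values item
`ComplexOrientationIdentity` (stmt-KontsevichZagierPeriods-11371) of route
`KontsevichZagierPeriods/ComplexOrientations`; the classification of the admissible conics and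
the slice itself are in the companion file `…ComplexOrientationIdentityConics`.
-/

noncomputable section

open Set MeasureTheory Metric Filter
open Literature.AlgebraicGeometry.RealAlgebraic (ovalInterior mem_ovalInterior_iff)
open Literature.Algebra.EuclideanLattices

namespace Summit.KontsevichZagierPeriods.ComplexOrientations

variable {A B C : ℝ} {Q : (Fin 2 → ℝ) → ℝ}

/-! ### Round sets in the plane `Fin 2 → ℝ`: polar coordinates -/

/-- Polar coordinates: every point of the plane is `(r cos θ, r sin θ)` with
`r = √(y₀² + y₁²)`. [folklore] -/
theorem exists_eq_sqrt_mul_cos_sin (y : Fin 2 → ℝ) :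
    ∃ θ : ℝ, y 0 = Real.sqrt (y 0 ^ 2 + y 1 ^ 2) * Real.cos θ ∧
      y 1 = Real.sqrt (y 0 ^ 2 + y 1 ^ 2) * Real.sin θ := by
  rcases (add_nonneg (sq_nonneg (y 0)) (sq_nonneg (y 1))).eq_or_lt with h0 | hpos
  · have h0' : y 0 = 0 := by nlinarith [sq_nonneg (y 0), sq_nonneg (y 1)]
    have h1' : y 1 = 0 := by nlinarith [sq_nonneg (y 0), sq_nonneg (y 1)]
    refine ⟨0, ?_, ?_⟩ <;> simp [h0', h1']
  · set r := Real.sqrt (y 0 ^ 2 + y 1 ^ 2) with hr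
    have hrpos : 0 < r := Real.sqrt_pos.2 hpos
    have hr2 : r ^ 2 = y 0 ^ 2 + y 1 ^ 2 := Real.sq_sqrt hpos.le
    have h1 : (y 0 / r) ^ 2 + (y 1 / r) ^ 2 = 1 := by
      rw [div_pow, div_pow, ← add_div, ← hr2, div_self (pow_ne_zero 2 hrpos.ne')]
    obtain ⟨θ, -, hc, hs⟩ := exists_cos_sin_of_sq_add_sq_eq_one h1
    refine ⟨2 * Real.pi * θ, ?_, ?_⟩
    · rw [hc]; field_simp
    · rw [hs]; field_simp

/-- The image of `I × ℝ` (`I ⊆ [0, ∞)`) under polar coordinates `(r, θ) ↦ (r cos θ, r sin θ)`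
is `{y | √(y₀²+y₁²) ∈ I}`. [folklore] -/
private theorem polar_image_prod_univ {I : Set ℝ} (hI : I ⊆ Ici 0) :
    (fun q : ℝ × ℝ => (![q.1 * Real.cos q.2, q.1 * Real.sin q.2] : Fin 2 → ℝ)) '' (I ×ˢ univ) =
      {y : Fin 2 → ℝ | Real.sqrt (y 0 ^ 2 + y 1 ^ 2) ∈ I} := by
  ext y
  simp only [mem_image, mem_prod, mem_univ, and_true, mem_setOf_eq, Prod.exists]
  constructor
  · rintro ⟨r, θ, hrI, rfl⟩
    simp only [Matrix.cons_val_zero, Matrix.cons_val_one]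
    have : (r * Real.cos θ) ^ 2 + (r * Real.sin θ) ^ 2 = r ^ 2 := by
      nlinarith [Real.cos_sq_add_sin_sq θ]
    rw [this, Real.sqrt_sq (hI hrI)]
    exact hrI
  · intro hy
    obtain ⟨θ, h0, h1⟩ := exists_eq_sqrt_mul_cos_sin y
    refine ⟨Real.sqrt (y 0 ^ 2 + y 1 ^ 2), θ, hy, ?_⟩
    ext i
    fin_cases i
    · simp [← h0]
    · simp [← h1]

/-- Polar coordinates are continuous. [folklore] -/
private theorem continuous_polar :
    Continuous fun q : ℝ × ℝ => (![q.1 * Real.cos q.2, q.1 * Real.sin q.2] : Fin 2 → ℝ) := by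
  fun_prop

/-- The circle `{y₀² + y₁² = ρ}` (`ρ > 0`) of the plane `Fin 2 → ℝ` is connected. [folklore] -/
theorem isConnected_setOf_sq_add_sq_eq {ρ : ℝ} (hρ : 0 < ρ) :
    IsConnected {y : Fin 2 → ℝ | y 0 ^ 2 + y 1 ^ 2 = ρ} := by
  have h : {y : Fin 2 → ℝ | y 0 ^ 2 + y 1 ^ 2 = ρ} =
      (fun q : ℝ × ℝ => (![q.1 * Real.cos q.2, q.1 * Real.sin q.2] : Fin 2 → ℝ)) ''
        ({Real.sqrt ρ} ×ˢ univ) := by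
    rw [polar_image_prod_univ (I := {Real.sqrt ρ}) (by simp [Real.sqrt_nonneg])]
    ext y
    simp only [mem_setOf_eq, mem_singleton_iff]
    constructor
    · intro h; rw [h]
    · intro h
      exact (Real.sqrt_inj (by positivity) hρ.le).1 h
  rw [h]
  exact ((isConnected_singleton).prod isConnected_univ).image _ continuous_polar.continuousOn

/-- The open disc `{y₀² + y₁² < ρ}` (`ρ > 0`) of the plane `Fin 2 → ℝ` is connected. [folklore] -/
theorem isConnected_setOf_sq_add_sq_lt {ρ : ℝ} (hρ : 0 < ρ) :
    IsConnected {y : Fin 2 → ℝ | y 0 ^ 2 + y 1 ^ 2 < ρ} := by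
  have h : {y : Fin 2 → ℝ | y 0 ^ 2 + y 1 ^ 2 < ρ} =
      (fun q : ℝ × ℝ => (![q.1 * Real.cos q.2, q.1 * Real.sin q.2] : Fin 2 → ℝ)) ''
        (Ico 0 (Real.sqrt ρ) ×ˢ univ) := by
    rw [polar_image_prod_univ (I := Ico 0 (Real.sqrt ρ)) (fun r hr => hr.1)]
    ext y
    simp only [mem_setOf_eq, mem_Ico, Real.sqrt_nonneg, true_and]
    rw [Real.sqrt_lt_sqrt_iff (by positivity)]
  rw [h]
  exact ((isConnected_Ico (Real.sqrt_pos.2 hρ)).prod isConnected_univ).image _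
    continuous_polar.continuousOn

/-- The exterior `{ρ < y₀² + y₁²}` (`ρ ≥ 0`) of a disc of the plane `Fin 2 → ℝ` is connected.
[folklore] -/
theorem isConnected_setOf_lt_sq_add_sq {ρ : ℝ} (hρ : 0 ≤ ρ) :
    IsConnected {y : Fin 2 → ℝ | ρ < y 0 ^ 2 + y 1 ^ 2} := by
  have h : {y : Fin 2 → ℝ | ρ < y 0 ^ 2 + y 1 ^ 2} =
      (fun q : ℝ × ℝ => (![q.1 * Real.cos q.2, q.1 * Real.sin q.2] : Fin 2 → ℝ)) ''
        (Ioi (Real.sqrt ρ) ×ˢ univ) := by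
    rw [polar_image_prod_univ (I := Ioi (Real.sqrt ρ))
      (fun r hr => le_trans (Real.sqrt_nonneg ρ) (le_of_lt (mem_Ioi.1 hr)))]
    ext y
    simp only [mem_setOf_eq, mem_Ioi]
    rw [show Real.sqrt ρ < Real.sqrt (y 0 ^ 2 + y 1 ^ 2) ↔ ρ < y 0 ^ 2 + y 1 ^ 2 from
      Real.sqrt_lt_sqrt_iff hρ]
  rw [h]
  exact ((isConnected_Ioi).prod isConnected_univ).image _ continuous_polar.continuousOn

/-! ### The ellipse `{Q(· − c) = ρ}` of a positive definite form -/

section Ellipse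

variable (hQ : ∀ x, Q x = A * x 0 ^ 2 + B * (x 0 * x 1) + C * x 1 ^ 2) (hA : 0 < A)
  (hD : 0 < 4 * A * C - B ^ 2)
include hQ hA hD

/-- A positive definite binary form is the Euclidean square norm after an invertible linear change
of coordinates: `Q = (T·)₀² + (T·)₁²` with `T = (√A x₀ + B x₁/(2√A), √D x₁/(2√A))`.
[folklore] -/
theorem exists_continuousLinearEquiv_binQF :
    ∃ T : (Fin 2 → ℝ) ≃L[ℝ] (Fin 2 → ℝ), ∀ x, (T x 0) ^ 2 + (T x 1) ^ 2 = Q x := by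
  set sA := Real.sqrt A with hsA
  set sD := Real.sqrt (4 * A * C - B ^ 2) with hsD
  have hsA0 : 0 < sA := Real.sqrt_pos.2 hA
  have hsD0 : 0 < sD := Real.sqrt_pos.2 hD
  have hsA2 : sA ^ 2 = A := Real.sq_sqrt hA.le
  have hsD2 : sD ^ 2 = 4 * A * C - B ^ 2 := Real.sq_sqrt hD.le
  have hQ' : ∀ x, Q x = sA ^ 2 * x 0 ^ 2 + B * (x 0 * x 1) +
      (sD ^ 2 + B ^ 2) / (4 * sA ^ 2) * x 1 ^ 2 := by
    intro x
    rw [hQ, hsA2, hsD2]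
    field_simp
    ring
  set M : Matrix (Fin 2) (Fin 2) ℝ := !![sA, B / (2 * sA); 0, sD / (2 * sA)] with hM
  have hL0 : ∀ x, Matrix.toLin' M x 0 = sA * x 0 + B / (2 * sA) * x 1 := fun x => by
    simp [hM, Matrix.toLin'_apply, Matrix.mulVec, dotProduct, Fin.sum_univ_two]
  have hL1 : ∀ x, Matrix.toLin' M x 1 = sD / (2 * sA) * x 1 := fun x => by
    simp [hM, Matrix.toLin'_apply, Matrix.mulVec, dotProduct, Fin.sum_univ_two]
  have hdet' : M.det = sD / 2 := by
    rw [hM, Matrix.det_fin_two_of]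
    field_simp
    ring
  have hdet : IsUnit M.det := by
    rw [hdet']
    exact isUnit_iff_ne_zero.2 (by positivity)
  refine ⟨(Matrix.toLinearEquiv' M (Matrix.invertibleOfIsUnitDet M hdet)).toContinuousLinearEquiv,
    fun x => ?_⟩
  have h0 : (Matrix.toLinearEquiv' M (Matrix.invertibleOfIsUnitDet M hdet)).toContinuousLinearEquiv
      x = Matrix.toLin' M x := by
    rw [LinearEquiv.coe_toContinuousLinearEquiv']
    exact LinearMap.congr_fun (Matrix.toLinearEquiv'_apply M _) x
  rw [h0, hL0, hL1, hQ']
  field_simp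
  ring

/-- The affine change of coordinates `v ↦ T (v − c)` straightening the ellipses centred at `c`:
a homeomorphism `Φ` of the plane with `(Φ v)₀² + (Φ v)₁² = Q (v − c)`. [folklore] -/
theorem exists_homeomorph_binQF_sub (c : Fin 2 → ℝ) :
    ∃ Φ : (Fin 2 → ℝ) ≃ₜ (Fin 2 → ℝ), ∀ v, (Φ v 0) ^ 2 + (Φ v 1) ^ 2 = Q (v - c) := by
  obtain ⟨T, hT⟩ := exists_continuousLinearEquiv_binQF hQ hA hD
  refine ⟨(Homeomorph.addRight (-c)).trans T.toHomeomorph, fun v => ?_⟩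
  show (T (v + -c) 0) ^ 2 + (T (v + -c) 1) ^ 2 = Q (v - c)
  rw [hT, ← sub_eq_add_neg]

omit hA hD in
/-- `w ↦ Q (w − c)` is continuous. [folklore] -/
theorem continuous_binQF_sub (c : Fin 2 → ℝ) : Continuous fun w => Q (w - c) :=
  (binQF_continuous hQ).comp (continuous_sub_right c)

/-- **The ellipse is connected** (`ρ > 0`). [folklore] -/
theorem isConnected_setOf_binQF_sub_eq (c : Fin 2 → ℝ) {ρ : ℝ} (hρ : 0 < ρ) :
    IsConnected {v : Fin 2 → ℝ | Q (v - c) = ρ} := by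
  obtain ⟨Φ, hΦ⟩ := exists_homeomorph_binQF_sub hQ hA hD c
  have h : {v : Fin 2 → ℝ | Q (v - c) = ρ} = Φ ⁻¹' {y | y 0 ^ 2 + y 1 ^ 2 = ρ} := by
    ext v; simp only [mem_setOf_eq, mem_preimage, hΦ]
  rw [h, Homeomorph.isConnected_preimage]
  exact isConnected_setOf_sq_add_sq_eq hρ

/-- The inside `{Q(· − c) < ρ}` of the ellipse is connected (`ρ > 0`). [folklore] -/
theorem isConnected_setOf_binQF_sub_lt (c : Fin 2 → ℝ) {ρ : ℝ} (hρ : 0 < ρ) :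
    IsConnected {v : Fin 2 → ℝ | Q (v - c) < ρ} := by
  obtain ⟨Φ, hΦ⟩ := exists_homeomorph_binQF_sub hQ hA hD c
  have h : {v : Fin 2 → ℝ | Q (v - c) < ρ} = Φ ⁻¹' {y | y 0 ^ 2 + y 1 ^ 2 < ρ} := by
    ext v; simp only [mem_setOf_eq, mem_preimage, hΦ]
  rw [h, Homeomorph.isConnected_preimage]
  exact isConnected_setOf_sq_add_sq_lt hρ

/-- The outside `{ρ < Q(· − c)}` of the ellipse is connected (`ρ ≥ 0`). [folklore] -/
theorem isConnected_setOf_lt_binQF_sub (c : Fin 2 → ℝ) {ρ : ℝ} (hρ : 0 ≤ ρ) :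
    IsConnected {v : Fin 2 → ℝ | ρ < Q (v - c)} := by
  obtain ⟨Φ, hΦ⟩ := exists_homeomorph_binQF_sub hQ hA hD c
  have h : {v : Fin 2 → ℝ | ρ < Q (v - c)} = Φ ⁻¹' {y | ρ < y 0 ^ 2 + y 1 ^ 2} := by
    ext v; simp only [mem_setOf_eq, mem_preimage, hΦ]
  rw [h, Homeomorph.isConnected_preimage]
  exact isConnected_setOf_lt_sq_add_sq hρ

/-- The inside of the ellipse is bounded. [folklore] -/
theorem isBounded_setOf_binQF_sub_lt (c : Fin 2 → ℝ) (ρ : ℝ) :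
    Bornology.IsBounded {v : Fin 2 → ℝ | Q (v - c) < ρ} := by
  obtain ⟨R, hR⟩ := (isBounded_binQF_le hQ hA hD ρ).exists_norm_le
  rw [isBounded_iff_forall_norm_le]
  refine ⟨R + ‖c‖, fun v hv => ?_⟩
  have h1 : ‖v - c‖ ≤ R := hR (v - c) (show Q (v - c) ≤ ρ from le_of_lt hv)
  calc ‖v‖ = ‖(v - c) + c‖ := by rw [sub_add_cancel]
    _ ≤ ‖v - c‖ + ‖c‖ := norm_add_le _ _
    _ ≤ R + ‖c‖ := by linarith

omit hD in
/-- The outside of the ellipse is unbounded: it contains `c + t e₀` for all large `t`.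
[folklore] -/
theorem not_isBounded_setOf_lt_binQF_sub (c : Fin 2 → ℝ) (ρ : ℝ) :
    ¬ Bornology.IsBounded {v : Fin 2 → ℝ | ρ < Q (v - c)} := by
  rw [isBounded_iff_forall_norm_le]
  push Not
  intro R
  set t : ℝ := max (|R| + ‖c‖ + 1) (Real.sqrt (|ρ| / A) + 1) with ht
  have ht1 : |R| + ‖c‖ + 1 ≤ t := le_max_left _ _
  have ht2 : Real.sqrt (|ρ| / A) + 1 ≤ t := le_max_right _ _
  have htpos : 0 < t := by
    have := abs_nonneg R; have := norm_nonneg c; linarith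
  set e : Fin 2 → ℝ := Pi.single 0 1 with he
  refine ⟨c + t • e, ?_, ?_⟩
  · -- `Q (t e₀) = A t² > ρ`
    rw [mem_setOf_eq, add_sub_cancel_left, binQF_smul hQ]
    have hval : Q e = A := by
      rw [hQ]; simp [he]
    rw [hval]
    have hs : Real.sqrt (|ρ| / A) < t := by linarith
    have hsq : |ρ| / A < t ^ 2 := by
      calc |ρ| / A = Real.sqrt (|ρ| / A) ^ 2 := (Real.sq_sqrt (by positivity)).symm
        _ < t ^ 2 := by gcongr
    rw [div_lt_iff₀ hA] at hsq
    linarith [le_abs_self ρ]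
  · -- `‖c + t e₀‖ ≥ |c₀ + t| > R`
    have h0 : (c + t • e) 0 = c 0 + t := by simp [he]
    have h1 : |c 0 + t| ≤ ‖c + t • e‖ := by
      rw [← h0, ← Real.norm_eq_abs]; exact norm_le_pi_norm _ 0
    have h2 : |c 0| ≤ ‖c‖ := by rw [← Real.norm_eq_abs]; exact norm_le_pi_norm _ 0
    have h3 : R < c 0 + t := by
      have := le_abs_self R; have := neg_abs_le (c 0); linarith
    calc R < c 0 + t := h3
      _ ≤ |c 0 + t| := le_abs_self _
      _ ≤ ‖c + t • e‖ := h1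

/-- **Components of the complement of an ellipse, inside**: the component of a point `v` with
`Q(v − c) < ρ` in the complement of the ellipse `{Q(· − c) = ρ}` is the inside `{Q(· − c) < ρ}`.
[folklore] -/
theorem connectedComponentIn_compl_ellipse_of_lt (c : Fin 2 → ℝ) {ρ : ℝ} (hρ : 0 < ρ)
    {v : Fin 2 → ℝ} (hv : Q (v - c) < ρ) :
    connectedComponentIn {w : Fin 2 → ℝ | Q (w - c) = ρ}ᶜ v = {w | Q (w - c) < ρ} := by
  have hopen₁ : IsOpen {w : Fin 2 → ℝ | Q (w - c) < ρ} :=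
    isOpen_lt (continuous_binQF_sub hQ c) continuous_const
  have hopen₂ : IsOpen {w : Fin 2 → ℝ | ρ < Q (w - c)} :=
    isOpen_lt continuous_const (continuous_binQF_sub hQ c)
  have hdisj : Disjoint {w : Fin 2 → ℝ | Q (w - c) < ρ} {w | ρ < Q (w - c)} :=
    Set.disjoint_left.2 fun w (h₁ : Q (w - c) < ρ) (h₂ : ρ < Q (w - c)) => lt_asymm h₁ h₂
  apply subset_antisymm
  · have hsub : connectedComponentIn {w : Fin 2 → ℝ | Q (w - c) = ρ}ᶜ v ⊆
        {w | Q (w - c) < ρ} ∪ {w | ρ < Q (w - c)} := fun w hw =>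
      lt_or_gt_of_ne (connectedComponentIn_subset _ _ hw)
    rcases isPreconnected_connectedComponentIn.subset_or_subset hopen₁ hopen₂ hdisj hsub with
      h | h
    · exact h
    · exact absurd (h (mem_connectedComponentIn (show v ∈ {w | Q (w - c) = ρ}ᶜ from hv.ne)))
        (lt_asymm hv)
  · exact (isConnected_setOf_binQF_sub_lt hQ hA hD c hρ).isPreconnected.subset_connectedComponentIn
      hv fun w hw => ne_of_lt hw

/-- **Components of the complement of an ellipse, outside**: the component of a point `v` with
`ρ < Q(v − c)` is the outside `{ρ < Q(· − c)}`. [folklore] -/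
theorem connectedComponentIn_compl_ellipse_of_gt (c : Fin 2 → ℝ) {ρ : ℝ} (hρ : 0 < ρ)
    {v : Fin 2 → ℝ} (hv : ρ < Q (v - c)) :
    connectedComponentIn {w : Fin 2 → ℝ | Q (w - c) = ρ}ᶜ v = {w | ρ < Q (w - c)} := by
  have hopen₁ : IsOpen {w : Fin 2 → ℝ | Q (w - c) < ρ} :=
    isOpen_lt (continuous_binQF_sub hQ c) continuous_const
  have hopen₂ : IsOpen {w : Fin 2 → ℝ | ρ < Q (w - c)} :=
    isOpen_lt continuous_const (continuous_binQF_sub hQ c)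
  have hdisj : Disjoint {w : Fin 2 → ℝ | Q (w - c) < ρ} {w | ρ < Q (w - c)} :=
    Set.disjoint_left.2 fun w (h₁ : Q (w - c) < ρ) (h₂ : ρ < Q (w - c)) => lt_asymm h₁ h₂
  apply subset_antisymm
  · have hsub : connectedComponentIn {w : Fin 2 → ℝ | Q (w - c) = ρ}ᶜ v ⊆
        {w | Q (w - c) < ρ} ∪ {w | ρ < Q (w - c)} := fun w hw =>
      lt_or_gt_of_ne (connectedComponentIn_subset _ _ hw)
    rcases isPreconnected_connectedComponentIn.subset_or_subset hopen₁ hopen₂ hdisj hsub with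
      h | h
    · exact absurd (h (mem_connectedComponentIn (show v ∈ {w | Q (w - c) = ρ}ᶜ from hv.ne')))
        (lt_asymm hv)
    · exact h
  · exact (isConnected_setOf_lt_binQF_sub hQ hA hD c hρ.le).isPreconnected.subset_connectedComponentIn
      hv fun w hw => ne_of_gt hw

/-- **The interior of the ellipse as an oval**: the route's `ovalInterior` (points off the ellipse
whose complementary component is bounded) of `{Q(· − c) = ρ}` is the inside `{Q(· − c) < ρ}`.
[folklore] -/
theorem ovalInterior_ellipse (c : Fin 2 → ℝ) {ρ : ℝ} (hρ : 0 < ρ) :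
    ovalInterior {w : Fin 2 → ℝ | Q (w - c) = ρ} = {w | Q (w - c) < ρ} := by
  ext v
  rw [mem_ovalInterior_iff]
  constructor
  · rintro ⟨hv, hb⟩
    rcases lt_or_gt_of_ne (show Q (v - c) ≠ ρ from hv) with h | h
    · exact h
    · rw [connectedComponentIn_compl_ellipse_of_gt hQ hA hD c hρ h] at hb
      exact absurd hb (not_isBounded_setOf_lt_binQF_sub hQ hA c ρ)
  · intro hv
    refine ⟨ne_of_lt hv, ?_⟩
    rw [connectedComponentIn_compl_ellipse_of_lt hQ hA hD c hρ hv]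
    exact isBounded_setOf_binQF_sub_lt hQ hA hD c ρ

/-- The ellipse itself is Lebesgue-null (a linear preimage of a Euclidean circle). [folklore] -/
theorem volume_setOf_binQF_eq (ρ : ℝ) : volume {x : Fin 2 → ℝ | Q x = ρ} = 0 := by
  rcases lt_or_ge ρ 0 with hρ | hρ
  · have : {x : Fin 2 → ℝ | Q x = ρ} = ∅ :=
      Set.eq_empty_of_forall_notMem fun x (hx : Q x = ρ) =>
        absurd (hx ▸ binQF_nonneg hQ hA hD x) (not_le.2 hρ)
    rw [this, measure_empty]
  obtain ⟨T, hT⟩ := exists_continuousLinearEquiv_binQF hQ hA hD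
  have hset : {x : Fin 2 → ℝ | Q x = ρ} = T ⁻¹' ((WithLp.toLp 2 : (Fin 2 → ℝ) →
      EuclideanSpace ℝ (Fin 2)) ⁻¹' sphere (0 : EuclideanSpace ℝ (Fin 2)) (Real.sqrt ρ)) := by
    ext x
    rw [mem_setOf_eq, mem_preimage, mem_preimage, mem_sphere_zero_iff_norm,
      EuclideanSpace.norm_eq, Fin.sum_univ_two]
    simp only [Real.norm_eq_abs, sq_abs, hT]
    rw [Real.sqrt_inj (binQF_nonneg hQ hA hD x) hρ]
  rw [hset, Measure.addHaar_preimage_continuousLinearEquiv,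
    (PiLp.volume_preserving_toLp (Fin 2)).measure_preimage
      isClosed_sphere.measurableSet.nullMeasurableSet,
    Measure.addHaar_sphere, mul_zero]

/-- **Area inside the ellipse**: `vol {Q(· − c) < ρ} = 2πρ/√D`, `D = 4AC − B²` — a
real-algebraic multiple of `π` for rational data. [folklore] -/
theorem volume_real_setOf_binQF_sub_lt (c : Fin 2 → ℝ) {ρ : ℝ} (hρ : 0 < ρ) :
    volume.real {w : Fin 2 → ℝ | Q (w - c) < ρ} =
      2 * Real.pi / Real.sqrt (4 * A * C - B ^ 2) * ρ := by
  have h1 : {w : Fin 2 → ℝ | Q (w - c) < ρ} = (fun w => w + -c) ⁻¹' {x | Q x < ρ} := by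
    ext w; simp only [mem_setOf_eq, mem_preimage, sub_eq_add_neg]
  have h2 : {x : Fin 2 → ℝ | Q x < ρ} = {x | Q x ≤ ρ} \ {x | Q x = ρ} := by
    ext x; simp only [mem_setOf_eq, Set.mem_sdiff]; exact lt_iff_le_and_ne
  rw [measureReal_def, h1, measure_preimage_add_right, h2,
    measure_sdiff_null (volume_setOf_binQF_eq hQ hA hD ρ), ← measureReal_def,
    volume_real_binQF_le hQ hA hD hρ]

end Ellipse

end Summit.KontsevichZagierPeriods.ComplexOrientations
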